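import Mathlib
import HarnessLib
import Summits.HubbardSuperconductivity.HubbardSuperconductivity.Theorems.KLProgrammeKLRegimeEnginePairTransferMemberTwoShellRoom

/-!
# Route `KLProgramme` — ENGINE item stmt-HubbardSuperconductivity-20437 `KLRegimeEngineV17F2`, stub (c) value lane, «(c)-OUT» (door map HOME/hubbard-kl-k3c2-p2/OUT-OF-CLASS-E2.md
# §2/§5): the member particle–hole TAIL (large leg transfer) BOOKED into `(Klam U)²·klEngGeo11.phGain` (cell gate-hubbard-kl, seat hubbard-kl-k3c2-p2 g18)

WHY.  Out of the pair class the member ph classes `RP/RQ` of `klmd_defect_le_rows` stand unconvolved (located «(c)-OUT-PH-FLAT»); their slot in (E2″-F)ₙ₊₁ is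
`(Klam U)²·klEngGeo11.phGain (n+1) ρ` at the LEG transfer `ρ = |p_{x−y}|_𝕋` (direct) / `|p_{x+y−Qm}|_𝕋` (crossed).  Above the threshold `G·ρ ≥ Λₙ₊₁/8` the sign-blind
two-shell rows of gen 17 (`Wd/Wx_member_row_le_slots`: `≤ c·(27/(8π²))·A·(16/π)(10+50Gβ/L)·(16384G²·min(ρ/Λₙ₊₁, Λₙ₊₁/ρ) + (√2/4)2⁻ⁿ)`) FIT that slot's two-shell branch
(`klTSA·klTwoShellProfile (n+1) ρ ≤ klEngGeo11.phGain (n+1) ρ`, `klTSA = 2⁶⁰·klTS`).  This file does the arithmetic, so the tail needs NO kernel flatness: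
* §1 `twoShell_slots_le_profile` — for `4 ≤ G`, `8Gβ ≤ L`, `0 ≤ c ≤ 512/3`, `0 ≤ ρ`: the row's bound `≤ 2²⁸·G²·A·klTwoShellProfile (n+1) ρ`
  (`27/(8π²) ≤ 3/8`, `16/π ≤ 16/3`, `10 + 50Gβ/L ≤ 17` ⇒ prefactor `≤ 2¹³`; `(√2/4)·2⁻ⁿ ≤ 2¹⁶·√klE0·2^{−(n+1)}`);
* §2 **`Wd_member_row_le_phGain_klEngGeo11`** / **`Wx_member_row_le_phGain_klEngGeo11`**: at the package (`A := klTS`, `U ≤ klTSU R`), above threshold, for every multiplier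
  `0 ≤ Mq` with `Mq·G² ≤ 2³²·(Klam U)²` (the closer's kernel-sup square `M4² ≤ (mA U)²`, `G = 4 + (8/3)Gfr₁U²`):
  `Mq·(Λₙ−Λₙ₊₁)((βL²)³)⁻¹·Wd_j(t,x,y) ≤ (Klam U)²·klEngGeo11.phGain (n+1) |p_{x−y}|_𝕋` (crossed: `|p_{x+y−Qm}|_𝕋`);
* §3 regime forms `…_of_regime` (`klBetaMin ≤ β`, `1 ≤ n ≤ n_β`, `8Gβ ≤ L` ⇒ `π/(4β) ≤ Λₙ₊₁`, `Gδ ≤ Λₙ₊₁`, `2Λₙ + Gδ ≤ klE0`).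
Arithmetic over landed rows; nothing about the model's kernels is asserted; nothing asserts (E2″-F), (c), K3 or superconductivity.  0 kit · 0 lit.
-/

noncomputable section

namespace Summit.HubbardSuperconductivity.HubbardSuperconductivity.Theorems.KLRegimeSplit

set_option linter.dupNamespace false -- summit = problem name (single-conjunct summit), D-0017

open Real Finset Set Literature.MathematicalPhysics.QuantumLattice Literature.Probability.LatticeModels
open Literature.MathematicalPhysics.QuantumLattice.FermiRG
open Summit.HubbardSuperconductivity.HubbardSuperconductivity.Theorems.KLProgrammeLegKernels
open Summit.HubbardSuperconductivity.HubbardSuperconductivity.Theorems.TwoPointAssembly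
open Summit.HubbardSuperconductivity.HubbardSuperconductivity.Theorems.DispersionFlow
open Summit.HubbardSuperconductivity.HubbardSuperconductivity.Theorems.KLRegimeWick
open Summit.HubbardSuperconductivity.HubbardSuperconductivity.Theorems.EngineV8
open Summit.HubbardSuperconductivity.HubbardSuperconductivity.Theorems.PerturbedFermiCurve

/-! ## §1 Arithmetic: the two-shell slots of the member rows against `klTwoShellProfile` -/

/-- `√klE0 ≥ 1/8` (`klE0 = 1/32 ≥ 1/64`). -/
theorem one_div_eight_le_sqrt_klE0 : 1 / 8 ≤ Real.sqrt klE0 := by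
  rw [show (1 : ℝ) / 8 = Real.sqrt ((1 / 8) ^ 2) by rw [Real.sqrt_sq (by norm_num)]]
  exact Real.sqrt_le_sqrt (by norm_num [klE0])

/-- **The member two-shell slots are below `2²⁸·G²·A·klTwoShellProfile (n+1) ρ`** (`0 ≤ A`, `4 ≤ G`, `8Gβ ≤ L`, `0 < L`, `0 ≤ β`, `0 ≤ c ≤ 512/3`, `0 ≤ ρ`). -/
theorem twoShell_slots_le_profile {A G β c ρ : ℝ} {L : ℝ} (hA : 0 ≤ A) (hG4 : 4 ≤ G) (hβ : 0 ≤ β) (hL : 0 < L) (hGβL : 8 * G * β ≤ L)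
    (hc0 : 0 ≤ c) (hc : c ≤ 512 / 3) (hρ : 0 ≤ ρ) (n : ℕ) :
    c * (27 / (8 * π ^ 2)) * A * (16 / π) * (10 + 50 * G * β / L) *
        (16384 * G ^ 2 * min (ρ / klScale klE0 (n + 1)) (klScale klE0 (n + 1) / ρ) + Real.sqrt 2 / 4 * ((2 : ℝ) ^ n)⁻¹) ≤
      2 ^ 28 * G ^ 2 * A * klTwoShellProfile (n + 1) ρ := by
  have hπ := Real.pi_pos
  have hπ3 : (3 : ℝ) ≤ π := by linarith [Real.pi_gt_three]
  have hG0 : 0 ≤ G := by linarith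
  -- the prefactor
  have h1 : 27 / (8 * π ^ 2) ≤ 3 / 8 := by
    rw [div_le_div_iff₀ (by positivity) (by norm_num)]; nlinarith
  have h2 : 16 / π ≤ 16 / 3 := div_le_div_of_nonneg_left (by norm_num) (by norm_num) hπ3
  have h3 : 10 + 50 * G * β / L ≤ 17 := by
    have : 50 * G * β / L ≤ 50 / 8 := by rw [div_le_div_iff₀ hL (by norm_num)]; nlinarith
    linarith
  have h30 : 0 ≤ 10 + 50 * G * β / L := by positivity
  have hpre : c * (27 / (8 * π ^ 2)) * A * (16 / π) * (10 + 50 * G * β / L) ≤ 2 ^ 13 * A := by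
    calc c * (27 / (8 * π ^ 2)) * A * (16 / π) * (10 + 50 * G * β / L)
        ≤ 512 / 3 * (3 / 8) * A * (16 / 3) * 17 := by gcongr
      _ ≤ 2 ^ 13 * A := by nlinarith
  have hpre0 : 0 ≤ c * (27 / (8 * π ^ 2)) * A * (16 / π) * (10 + 50 * G * β / L) := by positivity
  -- the bracket against the profile
  have hmax : max ρ 0 = ρ := max_eq_left hρ
  have hT : klTwoShellProfile (n + 1) ρ = min (ρ / klScale klE0 (n + 1)) (klScale klE0 (n + 1) / ρ) + Real.sqrt klE0 * ((2 : ℝ) ^ (n + 1))⁻¹ := by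
    unfold klTwoShellProfile; rw [hmax]
  have hmin0 : 0 ≤ min (ρ / klScale klE0 (n + 1)) (klScale klE0 (n + 1) / ρ) := by
    have := min_div_klScale_nonneg (n + 1) ρ; rwa [hmax] at this
  have hs2 : Real.sqrt 2 ≤ 2 := by
    rw [show (2 : ℝ) = Real.sqrt (2 ^ 2) by rw [Real.sqrt_sq (by norm_num)]]
    exact Real.sqrt_le_sqrt (by norm_num)
  have hk := one_div_eight_le_sqrt_klE0
  have h2n : 0 < ((2 : ℝ) ^ n)⁻¹ := by positivity
  have hcau : Real.sqrt 2 / 4 * ((2 : ℝ) ^ n)⁻¹ ≤ 2 ^ 15 * G ^ 2 * (Real.sqrt klE0 * ((2 : ℝ) ^ (n + 1))⁻¹) := by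
    have e : ((2 : ℝ) ^ (n + 1))⁻¹ = ((2 : ℝ) ^ n)⁻¹ / 2 := by rw [pow_succ, mul_inv]; ring
    rw [e]
    have hG16 : (16 : ℝ) ≤ G ^ 2 := by nlinarith
    have lhs : Real.sqrt 2 / 4 * ((2 : ℝ) ^ n)⁻¹ ≤ 1 / 2 * ((2 : ℝ) ^ n)⁻¹ := mul_le_mul_of_nonneg_right (by linarith) h2n.le
    have rhs : 2 ^ 15 * 16 * (1 / 8 * (((2 : ℝ) ^ n)⁻¹ / 2)) ≤ 2 ^ 15 * G ^ 2 * (Real.sqrt klE0 * (((2 : ℝ) ^ n)⁻¹ / 2)) := by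
      gcongr
    have mid : 1 / 2 * ((2 : ℝ) ^ n)⁻¹ ≤ 2 ^ 15 * 16 * (1 / 8 * (((2 : ℝ) ^ n)⁻¹ / 2)) := by nlinarith
    linarith
  have hbr : 16384 * G ^ 2 * min (ρ / klScale klE0 (n + 1)) (klScale klE0 (n + 1) / ρ) + Real.sqrt 2 / 4 * ((2 : ℝ) ^ n)⁻¹ ≤
      2 ^ 15 * G ^ 2 * klTwoShellProfile (n + 1) ρ := by
    rw [hT, mul_add]
    have : 16384 * G ^ 2 * min (ρ / klScale klE0 (n + 1)) (klScale klE0 (n + 1) / ρ) ≤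
        2 ^ 15 * G ^ 2 * min (ρ / klScale klE0 (n + 1)) (klScale klE0 (n + 1) / ρ) := by
      apply mul_le_mul_of_nonneg_right _ hmin0; nlinarith
    linarith
  have hbr0 : 0 ≤ 16384 * G ^ 2 * min (ρ / klScale klE0 (n + 1)) (klScale klE0 (n + 1) / ρ) + Real.sqrt 2 / 4 * ((2 : ℝ) ^ n)⁻¹ := by positivity
  calc _ ≤ 2 ^ 13 * A * (2 ^ 15 * G ^ 2 * klTwoShellProfile (n + 1) ρ) := mul_le_mul hpre hbr hbr0 (by positivity)
    _ = 2 ^ 28 * G ^ 2 * A * klTwoShellProfile (n + 1) ρ := by ring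

/-- The booking step: `Mq·(2²⁸·G²·klTS·T) ≤ (Klam U)²·klEngGeo11.phGain (n+1) ρ` when `Mq·G² ≤ 2³²(Klam U)²`. -/
theorem mul_profile_le_phGain_klEngGeo11 {Mq G Kl : ℝ} (hM : Mq * G ^ 2 ≤ 2 ^ 32 * Kl ^ 2) (n : ℕ) (ρ : ℝ) :
    Mq * (2 ^ 28 * G ^ 2 * klTS * klTwoShellProfile (n + 1) ρ) ≤ Kl ^ 2 * klEngGeo11.phGain (n + 1) ρ := by
  have hT0 : 0 ≤ klTwoShellProfile (n + 1) ρ := klTwoShellProfile_nonneg _ _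
  have hTS := klTS_nonneg
  have hbook := klTSA_twoShell_le_klEngGeo11_phGain (n + 1) ρ
  rw [klTSA_eq] at hbook
  calc Mq * (2 ^ 28 * G ^ 2 * klTS * klTwoShellProfile (n + 1) ρ) = Mq * G ^ 2 * 2 ^ 28 * (klTS * klTwoShellProfile (n + 1) ρ) := by ring
    _ ≤ 2 ^ 32 * Kl ^ 2 * 2 ^ 28 * (klTS * klTwoShellProfile (n + 1) ρ) := by gcongr
    _ = Kl ^ 2 * (2 ^ 60 * klTS * klTwoShellProfile (n + 1) ρ) := by ring
    _ ≤ Kl ^ 2 * klEngGeo11.phGain (n + 1) ρ := mul_le_mul_of_nonneg_left hbook (sq_nonneg _)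

/-! ## §2 The member ph tails booked into `(Klam U)²·klEngGeo11.phGain` -/

section Tail

variable {L M : ℕ} [NeZero L] [NeZero M] (β μ : ℝ) (K : TrigPolyC4v) {R : RenConsts} {U : ℝ} {N : ℕ}

/-- **DIRECT member ph tail in the `phGain` slot** (above threshold `G·|p_{x−y}|_𝕋 ≥ Λₙ₊₁/8`; package `klTS`/`klTSU`; `8Gβ ≤ L`; multiplier `0 ≤ Mq`, `Mq·G² ≤ 2³²(Klam U)²`):
`Mq·(Λₙ−Λₙ₊₁)((βL²)³)⁻¹·Wd_j(t,x,y) ≤ (Klam U)²·klEngGeo11.phGain (n+1) |p_{x−y}|_𝕋`. -/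
theorem Wd_member_row_le_phGain_klEngGeo11 (hR : R.WF2) (hU : 0 < U) (hUu : U ≤ klTSU R) (hμ : μ ∈ klWindowC) (hK : FrameOK R U N μ K)
    (hβ : 0 < β) (n : ℕ) {j : ℕ} (hj : n + 1 ≤ j) (hj'β : π / (4 * β) ≤ klScale klE0 (n + 1)) {t : ℝ} (ht : t ∈ Icc (0 : ℝ) 1)
    (hGδ : (4 + 8 / 3 * R.Gfr 1 * U ^ 2) * (2 * π / L) ≤ klScale klE0 (n + 1))
    (hE0 : 2 * klScale klE0 n + (4 + 8 / 3 * R.Gfr 1 * U ^ 2) * (2 * π / L) ≤ klE0) (hGL : 8 * (4 + 8 / 3 * R.Gfr 1 * U ^ 2) * β ≤ L)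
    {x y : TorusSite 2 L} (hlarge : klScale klE0 (n + 1) / 8 ≤ (4 + 8 / 3 * R.Gfr 1 * U ^ 2) * klTorusNorm L (x - y))
    {P : SplitConsts} {Mq : ℝ} (hMq : 0 ≤ Mq) (hM : Mq * (4 + 8 / 3 * R.Gfr 1 * U ^ 2) ^ 2 ≤ 2 ^ 32 * (P.Klam * U) ^ 2) :
    Mq * ((klScale klE0 n - klScale klE0 (n + 1)) * ((β * (L : ℝ) ^ 2) ^ 3)⁻¹ *
      ∑ p : FreqMomentum L M, ∑ _σ : Fin 2, ∑ p' : FreqMomentum L M,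
        (if matsubaraInt M p'.1 + matsubaraInt M (omega0 M) = matsubaraInt M p.1 + matsubaraInt M (omega0 M) ∧ p'.2 = p.2 + x - y then
          ‖((((softSymbolCompl L M β μ K (n + 1) j p + (hubbardCutoffWeightCT L M β μ K (klScale klE0 (n + 1)) p -
                hubbardCutoffWeightCT L M β μ K (klScale klE0 n + t * (klScale klE0 (n + 1) - klScale klE0 n)) p) : ℝ)) : ℂ) *
                (((β * (L : ℝ) ^ 2 : ℝ) : ℂ) * propCT L M β μ K p)) *
              ((((deriv (fun Λ' : ℝ => hubbardCutoffWeightCT L M β μ K Λ' p') (klScale klE0 n + t * (klScale klE0 (n + 1) - klScale klE0 n)) : ℝ)) : ℂ) *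
                (((β * (L : ℝ) ^ 2 : ℝ) : ℂ) * propCT L M β μ K p')) +
            ((((deriv (fun Λ' : ℝ => hubbardCutoffWeightCT L M β μ K Λ' p) (klScale klE0 n + t * (klScale klE0 (n + 1) - klScale klE0 n)) : ℝ)) : ℂ) *
                (((β * (L : ℝ) ^ 2 : ℝ) : ℂ) * propCT L M β μ K p)) *
              ((((softSymbolCompl L M β μ K (n + 1) j p' + (hubbardCutoffWeightCT L M β μ K (klScale klE0 (n + 1)) p' -
                hubbardCutoffWeightCT L M β μ K (klScale klE0 n + t * (klScale klE0 (n + 1) - klScale klE0 n)) p') : ℝ)) : ℂ) *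
                (((β * (L : ℝ) ^ 2 : ℝ) : ℂ) * propCT L M β μ K p'))‖
        else 0)) ≤
      (P.Klam * U) ^ 2 * klEngGeo11.phGain (n + 1) (klTorusNorm L (x - y)) := by
  have hL : (0 : ℝ) < L := by exact_mod_cast Nat.pos_of_ne_zero (NeZero.ne L)
  have hGfr : 0 ≤ R.Gfr 1 := hR.wf.2.2 1
  set G : ℝ := 4 + 8 / 3 * R.Gfr 1 * U ^ 2 with hG
  have h83 : 0 ≤ 8 / 3 * R.Gfr 1 * U ^ 2 := by positivity
  have hG4 : 4 ≤ G := by rw [hG]; linarith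
  have hρ : 0 ≤ klTorusNorm L (x - y) := by
    by_contra h0; push Not at h0
    have : G * klTorusNorm L (x - y) ≤ 0 := mul_nonpos_of_nonneg_of_nonpos (by linarith) h0.le
    linarith [klth_klScale_pos (n + 1)]
  have hrow := Wd_member_row_le_slots (M := M) β μ K twoShellFrameAreaAt_klTS klTS_nonneg hR hU hUu hμ hK hβ n hj hj'β ht hGδ hE0 hlarge
  have hslots := twoShell_slots_le_profile (c := 512 / 3) klTS_nonneg hG4 hβ.le hL hGL (by norm_num) le_rfl hρ n
  have hbook := mul_profile_le_phGain_klEngGeo11 hM n (klTorusNorm L (x - y))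
  exact (mul_le_mul_of_nonneg_left (hrow.trans hslots) hMq).trans hbook

/-- **CROSSED member ph tail in the `phGain` slot** (above threshold `G·|p_{x+y−Qm}|_𝕋 ≥ Λₙ₊₁/8`; otherwise as `Wd_member_row_le_phGain_klEngGeo11`):
`Mq·(Λₙ−Λₙ₊₁)((βL²)³)⁻¹·Wx_j(t,x,y) ≤ (Klam U)²·klEngGeo11.phGain (n+1) |p_{x+y−Qm}|_𝕋`. -/
theorem Wx_member_row_le_phGain_klEngGeo11 (hR : R.WF2) (hU : 0 < U) (hUu : U ≤ klTSU R) (hμ : μ ∈ klWindowC) (hK : FrameOK R U N μ K)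
    (hβ : 0 < β) (n : ℕ) {j : ℕ} (hj : n + 1 ≤ j) (hj'β : π / (4 * β) ≤ klScale klE0 (n + 1)) {t : ℝ} (ht : t ∈ Icc (0 : ℝ) 1)
    (hGδ : (4 + 8 / 3 * R.Gfr 1 * U ^ 2) * (2 * π / L) ≤ klScale klE0 (n + 1))
    (hE0 : 2 * klScale klE0 n + (4 + 8 / 3 * R.Gfr 1 * U ^ 2) * (2 * π / L) ≤ klE0) (hGL : 8 * (4 + 8 / 3 * R.Gfr 1 * U ^ 2) * β ≤ L)
    {Qm x y : TorusSite 2 L} (hlarge : klScale klE0 (n + 1) / 8 ≤ (4 + 8 / 3 * R.Gfr 1 * U ^ 2) * klTorusNorm L (x + y - Qm))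
    {P : SplitConsts} {Mq : ℝ} (hMq : 0 ≤ Mq) (hM : Mq * (4 + 8 / 3 * R.Gfr 1 * U ^ 2) ^ 2 ≤ 2 ^ 32 * (P.Klam * U) ^ 2) :
    Mq * ((klScale klE0 n - klScale klE0 (n + 1)) * ((β * (L : ℝ) ^ 2) ^ 3)⁻¹ *
      ∑ p : FreqMomentum L M, ∑ p' : FreqMomentum L M,
        (if matsubaraInt M p'.1 + matsubaraInt M (omega0 M) + matsubaraInt M (omega0 M) + 1 = matsubaraInt M p.1 ∧ p'.2 = p.2 + Qm - x - y then
          ‖((((softSymbolCompl L M β μ K (n + 1) j p + (hubbardCutoffWeightCT L M β μ K (klScale klE0 (n + 1)) p -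
                hubbardCutoffWeightCT L M β μ K (klScale klE0 n + t * (klScale klE0 (n + 1) - klScale klE0 n)) p) : ℝ)) : ℂ) *
                (((β * (L : ℝ) ^ 2 : ℝ) : ℂ) * propCT L M β μ K p)) *
              ((((deriv (fun Λ' : ℝ => hubbardCutoffWeightCT L M β μ K Λ' p') (klScale klE0 n + t * (klScale klE0 (n + 1) - klScale klE0 n)) : ℝ)) : ℂ) *
                (((β * (L : ℝ) ^ 2 : ℝ) : ℂ) * propCT L M β μ K p')) +
            ((((deriv (fun Λ' : ℝ => hubbardCutoffWeightCT L M β μ K Λ' p) (klScale klE0 n + t * (klScale klE0 (n + 1) - klScale klE0 n)) : ℝ)) : ℂ) *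
                (((β * (L : ℝ) ^ 2 : ℝ) : ℂ) * propCT L M β μ K p)) *
              ((((softSymbolCompl L M β μ K (n + 1) j p' + (hubbardCutoffWeightCT L M β μ K (klScale klE0 (n + 1)) p' -
                hubbardCutoffWeightCT L M β μ K (klScale klE0 n + t * (klScale klE0 (n + 1) - klScale klE0 n)) p') : ℝ)) : ℂ) *
                (((β * (L : ℝ) ^ 2 : ℝ) : ℂ) * propCT L M β μ K p'))‖
        else 0)) ≤
      (P.Klam * U) ^ 2 * klEngGeo11.phGain (n + 1) (klTorusNorm L (x + y - Qm)) := by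
  have hL : (0 : ℝ) < L := by exact_mod_cast Nat.pos_of_ne_zero (NeZero.ne L)
  have hGfr : 0 ≤ R.Gfr 1 := hR.wf.2.2 1
  set G : ℝ := 4 + 8 / 3 * R.Gfr 1 * U ^ 2 with hG
  have h83 : 0 ≤ 8 / 3 * R.Gfr 1 * U ^ 2 := by positivity
  have hG4 : 4 ≤ G := by rw [hG]; linarith
  have hρ : 0 ≤ klTorusNorm L (x + y - Qm) := by
    by_contra h0; push Not at h0
    have : G * klTorusNorm L (x + y - Qm) ≤ 0 := mul_nonpos_of_nonneg_of_nonpos (by linarith) h0.le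
    linarith [klth_klScale_pos (n + 1)]
  have hrow := Wx_member_row_le_slots (M := M) β μ K twoShellFrameAreaAt_klTS klTS_nonneg hR hU hUu hμ hK hβ n hj hj'β ht hGδ hE0 hlarge
  have hslots := twoShell_slots_le_profile (c := 256 / 3) klTS_nonneg hG4 hβ.le hL hGL (by norm_num) (by norm_num) hρ n
  have hbook := mul_profile_le_phGain_klEngGeo11 hM n (klTorusNorm L (x + y - Qm))
  exact (mul_le_mul_of_nonneg_left (hrow.trans hslots) hMq).trans hbook

end Tail

/-! ## §3 Regime forms -/

section Regime

variable {L M : ℕ} [NeZero L] [NeZero M] (β μ : ℝ) (K : TrigPolyC4v) {R : RenConsts} {U : ℝ} {N : ℕ}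

omit [NeZero L] [NeZero M] in
/-- The three scale readings of the tail rows from the regime: `klBetaMin ≤ β`, `1 ≤ n ≤ n_β`, `8Gβ ≤ L` ⇒ `π/(4β) ≤ Λₙ₊₁`, `Gδ ≤ Λₙ₊₁`, `2Λₙ + Gδ ≤ klE0`. -/
theorem tail_regime_readings (hR : R.WF2) (hβ : klBetaMin ≤ β) {n : ℕ} (hn1 : 1 ≤ n) (hn : n ≤ nScales β)
    (hGL : 8 * (4 + 8 / 3 * R.Gfr 1 * U ^ 2) * β ≤ L) :
    π / (4 * β) ≤ klScale klE0 (n + 1) ∧ (4 + 8 / 3 * R.Gfr 1 * U ^ 2) * (2 * π / L) ≤ klScale klE0 (n + 1) ∧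
      2 * klScale klE0 n + (4 + 8 / 3 * R.Gfr 1 * U ^ 2) * (2 * π / L) ≤ klE0 := by
  have hGfr : 0 ≤ R.Gfr 1 := hR.wf.2.2 1
  have h83 : 0 ≤ 8 / 3 * R.Gfr 1 * U ^ 2 := by positivity
  have hG0 : 0 ≤ 4 + 8 / 3 * R.Gfr 1 * U ^ 2 := by linarith
  have h1 := pi_div_four_mul_le_klScale_of_le_nScales_succ hβ (show n + 1 ≤ nScales β + 1 by omega)
  obtain ⟨h2, -⟩ := lattice_fattening_le_of_regime hβ hG0 hGL hn1 hn
  have hsucc : klScale klE0 (n + 1) = klScale klE0 n / 4 := klth_klScale_succ n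
  have hΛle : klScale klE0 n ≤ klE0 / 4 := by
    have h := klld_klScale_anti (n := 1) (m := n) hn1
    have e : klScale klE0 1 = klE0 / 4 := by unfold klScale; ring
    linarith
  refine ⟨h1, h2, ?_⟩
  rw [hsucc] at h2
  have hE0 : (0 : ℝ) < klE0 := by unfold klE0; norm_num
  linarith

end Regime

end Summit.HubbardSuperconductivity.HubbardSuperconductivity.Theorems.KLRegimeSplit

end
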